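import Mathlib
import HarnessLib
import HarnessLib.Audit
import Summits.AtomisticToContinuum.Statement
import Literature.MathematicalPhysics.KineticTheory.LangevinChainNESS
import Summits.AtomisticToContinuum.FouriersLaw.Theorems.EmbeddedDrudeMourreNessUnique
import Summits.AtomisticToContinuum.FouriersLaw.Theorems.FourierGreenKuboFourierFiniteResponseOfUnique

/-!
Route: BathRenormalisation

CLOSED (retired) 2026-08-15T13:41:07Z by operator:999:1257524 — reason: not-a-thesis: assembly does not conclude the sub-problem Statement — note: D-0027 §2.1 audit (human 2026-08-15: routes that do not decide the summit are removed): the assembly concludes `Literature.MathematicalPhysics.KineticTheory.HeatConduction.FouriersLaw`, not the sub-problem statement; a NEW conforming route may be opened from the same idea (generated `closes : … → _r. The file is kept as the record of this route; refuted decls are indexed as negative knowledge (`ledger negatives`).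

# Route BathRenormalisation — Fourier's law as the parabolic fixed point of the add-one-site bath
map — resistance increments 1/G_{N+1} − 1/G_N → 1/κ

X (PARABOLIC ORBIT LAW; realises card bath-renormalisation-parabolic-fixed-point): for pinnedChain
ω₂ lam β γ (all > 0), under uniqueness of weak steady states, for every T > 0 there is r*(T) ∈ (0,∞)
such that for every steady-state family and every sequence G with G_N = lim_{δ→0,δ≠0}
totalCurrent(μ_{N,T+δ/2,T−δ/2})/((N−1)δ) (N ≥ 2; G_N = D_N/(N−1) is the linear-response CONDUCTANCE
of the N-chain, totalCurrent = (N−1)·J̃) the resistance increments converge: 1/G_{N+1} − 1/G_N →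
r*(T).
Dictionary (card): G_N = g(Φ^{N−1}B_R) is the one-site DC conductance functional evaluated along the
orbit of the Langevin bath B_R under the bath map Φ = "attach one pinned anharmonic site"; X says
the orbit approaches the CLOSED fixed point B* (the semi-infinite equilibrium chain seen from its
end, g(B*) = 0) through a non-degenerate parabolic germ g ↦ g − r*g² + o(g²): one more atom adds one
resistance quantum, and κ(T) = 1/r*(T) is the inverse quadratic coefficient. The existential
environment-space form of the card's thesis (∃ 𝔅_T, Φ, g, B* realising the orbit with
OrbitConvergence ∧ OneSiteSeriesLemma ∧ Recurrence) is EQUIVALENT to X (one-point compactification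
of the orbit), so X is the typed thesis and the environment space is the proof strategy (Two-layer
plan, Definition requests).
X is decomposed into three nested exclusions of fixed-point types: Recurrence (kills the
elliptic/ballistic type) → ResistanceQuantum (kills the degenerate-tangency/anomalous type) →
ParabolicGerm (kills oscillation and the hyperbolic/insulating type, identifies r*). Then D_N =
(N−1)G_N → κ(T) by Cesàro, and with clause (i) (fact CuneoEckmannHairerReyBellet2018_pinnedChain +
NessUnique) and FiniteResponseOfUnique this is FouriersLawFor (pinnedChain …) for all parameters,
i.e. FouriersLaw.
Lean: `∀ ω₂ lam β γ : ℝ, 0 < ω₂ → 0 < lam → 0 < β → 0 < γ → (∀ (N : ℕ) (T_L T_R : ℝ), 0 < T_L → 0 <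
T_R → ∀ μ ν : MeasureTheory.Measure
(Literature.MathematicalPhysics.KineticTheory.HeatConduction.PhaseSpace N),
(Literature.MathematicalPhysics.KineticTheory.HeatConduction.pinnedChain ω₂ lam β γ).IsSteadyState N
T_L T_R μ → (Literature.MathematicalPhysics.KineticTheory.HeatConduction.pinnedChain ω₂ lam β
γ).IsSteadyState N T_L T_R ν → μ = ν) → ∀ T : ℝ, 0 < T → ∃ r : ℝ, 0 < r ∧ ∀ μ : (N : ℕ) → ℝ → ℝ →
MeasureTheory.Measure (Literature.MathematicalPhysics.KineticTheory.HeatConduction.PhaseSpace N), (∀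
(N : ℕ) (T_L T_R : ℝ), 0 < T_L → 0 < T_R →
(Literature.MathematicalPhysics.KineticTheory.HeatConduction.pinnedChain ω₂ lam β γ).IsSteadyState N
T_L T_R (μ N T_L T_R)) → ∀ G : ℕ → ℝ, (∀ N : ℕ, 2 ≤ N → Filter.Tendsto (fun δ : ℝ =>
(Literature.MathematicalPhysics.KineticTheory.HeatConduction.pinnedChain ω₂ lam β γ).totalCurrent (μ
N (T + δ / 2) (T - δ / 2)) / (((N : ℝ) - 1) * δ)) (nhdsWithin 0 {(0 : ℝ)}ᶜ) (nhds (G N))) →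
Filter.Tendsto (fun N : ℕ => (G (N + 1))⁻¹ - (G N)⁻¹) Filter.atTop (nhds r)`

## Assembly
Glue (real analysis, ≈ 60 lines; sketch elaborated rc 0 in the planner folder): fix parameters.
Clause (i): existence from the fact CuneoEckmannHairerReyBellet2018_pinnedChain (N ≥ 1) and
OscillatorChain.isSteadyState_zero (N = 0), uniqueness from NessUnique. Clause (ii): for T > 0 take
r from ParabolicGerm and a from ResistanceQuantum and set κ(T) := 1/r (κ := 1 for T ≤ 0); along the
canonical family (which exists by the fact) OhmicSign and Recurrence discharge the antecedents, so
eventually a ≤ increments → r, whence r ≥ a > 0. For an arbitrary family μ: D_N from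
FiniteResponseOfUnique, G_N := D_N/(N−1) for N ≥ 2 satisfies the conductance hypothesis
(totalCurrent/((N−1)δ) = (totalCurrent/δ)/(N−1)); uniqueness makes μ agree with the canonical family
at all positive temperatures, so limits along 𝓝[≠]0 coincide; 1/G_N = 1/G_2 + Σ_{2≤k<N}(1/G_{k+1} −
1/G_k) and Cesàro (Mathlib Filter.Tendsto.cesaro) give (1/G_N)/N → r, hence D_N = (N−1)G_N → 1/r =
κ(T) > 0. The conjunct constant is
Literature.MathematicalPhysics.KineticTheory.HeatConduction.FouriersLaw (= the abbrev FouriersLaw of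
Summits/AtomisticToContinuum/FouriersLaw/Statement.lean, as in route FourierGreenKubo's accepted
assemblies).

Rationale: WHY THIS LINE. Mechanism (card): regroup the (N+1)-chain as ONE thermostatted site facing the
composite environment Φ^N(B_R); all N-dependence of BLR's clause (ii) (BonettoLebowitzReyBellet2000
§5.3 (33)) is then the orbit of the Langevin bath under Φ on thermal environments at temperature T,
and Fourier's law is the statement that Φ is PARABOLIC at the semi-infinite chain, κ being the
inverse quadratic coefficient; the three catalogued behaviours are the three other textbook types of
a one-dimensional fixed point — g* > 0 (elliptic Möbius level, harmonic member,
RiederLebowitzLieb1967), hyperbolic at 0 (disordered harmonic chain, random Möbius products,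
AjankiHuveneers2011), degenerate tangency (anomalous, unpinned FPU). Imported areas, with explicit
dictionary: one-dimensional dynamics (parabolic germs / Fatou coordinates) as organising language;
the scaling theory of localisation (AbrahamsEtAl1979, AndersonEtAl1980: composition law of
resistances under added length, Ohmic ⇔ 1/g additive, localised ⇔ multiplicative) with g ↔ DC
thermal conductance through one thermostatted site and L ↔ N; open-quantum-systems chain mappings
(WoodsEtAl2014: residual spectral densities converge to a fixed point = the Gaussian level of Φ, a
Möbius map of the boundary Herglotz function, contracting under dissipation by Schwarz–Pick). What
this line does that route FourierGreenKubo does not: no infinite-volume Green–Kubo object and no κ =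
κ_GK identification; the thermodynamic limit is taken along the recursion N ↦ N+1 through boundary
(contact) functionals only, and every typed crux is a statement about ONE real sequence G_N of
finite-chain linear responses, each lying strictly between the catalogued necessary waypoint
HasBoundedResponse and the conjunct or strictly below it (Recurrence), each excluding one transport
class. Empirical anchors: AokiKusnezov2000 (φ⁴ chains: boundary jumps T_c − T_c⁰ ≃ α⟨J⟩ with
thermostat-dependent α, bulk κ thermostat-independent, i.e. R_N ≈ 2α + N/κ), AokiLukkarinenSpohn2006
(J ∼ 1/N for the pinned quartic chain). Negatives index empty at filing.

RANKED CRUXES. #0 BathOrbitParabolic (target) — X of § Thesis: under weak-NESS uniqueness, for every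
T > 0 there is r > 0 such that for every steady-state family and every conductance sequence G (G_N =
lim_δ totalCurrent(μ_{N,T+δ/2,T−δ/2})/((N−1)δ) for N ≥ 2) the resistance increments 1/G_{N+1} −
1/G_N → r; κ(T) = 1/r. Cheap from the three cruxes + OhmicSign (r ≥ a > 0). (why it might fail:
strictly stronger than FouriersLaw (which needs only R_N/N → 1/κ): increments may tend to 0
(anomalous κ_N → ∞ despite pinning), oscillate at O(1) (coherent finite-size structure), or G_N ↛ 0
(hidden conserved quantity, Mazur).) [BonettoLebowitzReyBellet2000, AokiKusnezov2000,
AbrahamsEtAl1979, AndersonEtAl1980, AjankiHuveneers2011]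
#2 ParabolicGerm (crux) — card items OneSiteSeriesLemma ∘ OrbitConvergence restricted to the orbit:
GIVEN that the orbit enters every DC-neighbourhood of the closed environment (G_N → 0) and G_N > 0
(N ≥ 2), the resistance increments 1/G_{N+1} − 1/G_N CONVERGE to a real limit r (r(E_N) → r(B*): Φ
has a C² germ at B* along the orbit; quantifiers ∀T ∃r ∀family, legitimate under uniqueness). With
ResistanceQuantum r ≥ a > 0 and κ = 1/r. Excludes the oscillatory and the hyperbolic/insulating
(increments → ∞) types. [deps: Recurrence, ResistanceQuantum, OhmicSign] [difficulty: open-problem]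
(why it might fail: a persistent O(1) finite-size oscillation of R_N − N/κ (period-2 band-edge or
contact resonances surviving at T > 0) leaves Fourier true but the increments divergent; and
DC-continuity of r at B* IS N-uniform time-integrability of the junction force correlations.)
[BonettoLebowitzReyBellet2000 §5.3 and §7, AokiKusnezov2000, WoodsEtAl2014, Dhar2008 §3,
AndersonEtAl1980]
#3 ResistanceQuantum (crux) — GIVEN G_N → 0 and G_N > 0 (N ≥ 2), eventually every added site costs
at least a fixed resistance quantum: ∃ a > 0 with 1/G_{N+1} − 1/G_N ≥ a for all large N (r bounded
away from 0 near B*: non-degenerate quadratic tangency; quantifiers ∀T ∃a ∀family). Consequences: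
R_N ≥ aN/2 eventually, hence sup_N D_N < ∞ (HasBoundedResponse along the unique family) and eventual
monotonicity of G_N. Excludes the anomalous (superdiffusive, tangency order < 2) type. [deps:
Recurrence, OhmicSign] [difficulty: open-problem] (why it might fail: superdiffusion at some (T, ω₂,
lam, β) would send the increments to 0 (believed excluded by pinning, AokiLukkarinenSpohn2006,
unproved); or G_N fails to be eventually monotone (a non-positive increment infinitely often) even
with Ohmic averages.) [AokiLukkarinenSpohn2006, LepriLiviPoliti2003, BonettoLebowitzReyBellet2000
§6.3, decl Literature.Barriers.AtomisticToContinuum.HasBoundedResponse, decl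
Literature.Barriers.AtomisticToContinuum.LukkarinenSpohn2008_lemma41]
#4 Recurrence (crux) — card item Recurrence (g(B*) = 0) on the orbit: the chain conductance tends to
zero, G_N(T) → 0 as N → ∞, for every steady-state family under uniqueness — the semi-infinite pinned
anharmonic chain is CLOSED at DC, no ballistic channel; equivalently D_N = o(N). Strictly weaker
than HasBoundedResponse and than the conjunct; the first deliverable. Excludes the
elliptic/ballistic type (the harmonic member fails exactly here: G_N → c_∞ > 0). [difficulty:
open-problem] (why it might fail: a local conserved quantity of the quartic pinned chain overlapping
the energy current (Mazur ⇒ Drude weight > 0 ⇒ G_N ↛ 0), or exact non-radiating moving breathers;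
none is known, but integrability is excluded only numerically.) [Mazur1969, decl
Literature.Barriers.AtomisticToContinuum.Mazur1969_inequality, Dhar2008, RiederLebowitzLieb1967,
decl Literature.Barriers.AtomisticToContinuum.HarmonicChainBallisticFlux, KunduDharNarayan2009]
#9 OhmicSign (support) — strict positivity of the finite-N conductance, G_N(T) > 0 for all N ≥ 2,
every steady-state family under uniqueness (non-degeneracy of the finite-volume Kubo variance of the
contact power w_L = γ(T − p_0²): w_L is not a coboundary L h with ∂_p h = 0 on the bath momenta).
Print-level routine given the finite-volume Green–Kubo formula (ReyBellet2003 Rem 4.4 (56)) and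
strict entropy production (EckmannPilletReyBellet1999b); infrastructure-heavy in Lean (Markov
semigroup of the chain). Load-bearing: antecedent of ResistanceQuantum and ParabolicGerm.
[difficulty: L] [ReyBellet2003, EckmannPilletReyBellet1999b, CuneoEckmannHairerReyBellet2018]
#9 NessUnique (support) — identical signature to stmt-AtomisticToContinuum-0741 (route
FourierGreenKubo; shared item): uniqueness of the weak steady state in the class IsSteadyState for
pinnedChain, all N and T_L, T_R > 0 (print: CuneoEckmannHairerReyBellet2018 Thm 2.13(1) for the
semigroup; plus the Fokker–Planck identification lemma). With the landed fact
CuneoEckmannHairerReyBellet2018_pinnedChain it is clause (i). [difficulty: L]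
[CuneoEckmannHairerReyBellet2018, Carmona2007]
#9 FiniteResponseOfUnique (support) — identical signature to stmt-AtomisticToContinuum-0717 (route
FourierGreenKubo; shared item): under uniqueness, for every steady-state family, T > 0 and N the
finite-N response limit D_N = lim_{δ→0,δ≠0} totalCurrent(μ_{N,T+δ/2,T−δ/2})/δ exists
(differentiability of NESS expectations in the bath temperatures at equilibrium). Supplies the
conductance sequences G_N = D_N/(N−1). [difficulty: L] [ReyBellet2003, HairerMajda2009,
CuneoEckmannHairerReyBellet2018]

TWO-LAYER PLAN. Foreseen glued splits (k ≤ 3, depth 1), filed only after a crux closes or the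
definition request lands: ParabolicGerm ⇐ JunctionLocality → OrbitTail → ParabolicGerm, where
JunctionLocality is the card's OneSiteSeriesLemma in typed form over INHOMOGENEOUS environments (the
resistance added by one standard site in front of an environment whose first k sites are standard
pinnedChain sites and whose far part is any finite Markov thermal environment at T with conductance
≤ g lies within ε(k, g) of r*, ε → 0 as k → ∞, g → 0: locality of the insertion resistance) and
OrbitTail says the orbit E_N eventually lies in that class with g(E_N) → 0 (immediate from
Recurrence); ResistanceQuantum ⇐ InsertionCostLowerBound (N-uniform lower bound on the resistance
added by one site in front of any nearly closed environment of that class) → OrbitTail →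
ResistanceQuantum; Recurrence ⇐ NoHiddenCharge → OpenChainMazurBridge (vanishing Drude weight ⇒ G_N
→ 0, cf. cards open-chain-mazur-bridge, no-hidden-charges-hydro-projection) → Recurrence. The linear
(Gaussian) level — Φ as the Möbius map Σ ↦ 1/(ω₂ + 2 − ω² − Σ), elliptic in the band, hyperbolic at
DC, Schwarz–Pick contraction under Im > 0 — is the model each child is calibrated against.

KILL CRITERIA. ¬Recurrence (G_N ↛ 0 along the unique family: a ballistic component) refutes the
conjunct itself (hasBoundedResponse_of_fouriersLawFor): close refuted:Recurrence and file
¬FouriersLaw with the witness. ¬ResistanceQuantum by increments → 0 (anomalous scaling) likewise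
refutes FouriersLaw (κ_N → ∞); ¬ResistanceQuantum by non-monotone G_N with Ohmic Cesàro averages
forces a pivot — restate with averaged increments, at which point the line degenerates into the
Fekete/additivity line (cards fekete-resistance-subadditivity, insertion-cost-superadditive-half)
and should be closed superseded. ¬ParabolicGerm by bounded non-convergent increments with convergent
averages: pivot to the averaged germ (restate ParabolicGerm with Cesàro means; the fixed-point
picture survives only in averaged form); ¬ParabolicGerm by increments → ∞: FouriersLaw is false (κ =
0, insulating). If route FourierGreenKubo closes ThermodynamicLimit + GreenKubo first, this route is
mooted for the conjunct; its cruxes stay as finer statements (close superseded, items kept as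
support).

NOT DECOMPOSED YET. The environment space 𝔅_T, the map Φ and the functional g OFF the orbit
(definition request), the uniform junction-locality lemma and the half-line end process hosting B*
and OrbitConvergence literally (Two-layer plan); the calibrations N = 1 (G_1 = γ/2 exactly), N = 2
and the harmonic consistency check (elliptic Möbius level: increments → 0, G_N → c_∞ > 0 along the
harmonic orbit) — support statements for idle provers later; the finite-size germ fingerprint
(analytic germ ⇒ R_N − r*N ∼ c·log N, hydrodynamic t^{−3/2} tail ⇒ c·√N) — a numerical deliverable,
not an item; γ-independence of r* (intrinsic fixed point; other cards:
gamma-parity-contacts-forgotten, dense-gamma-suffices, bath-coupling-comparison); T-continuity of κ.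

CHEAPEST FALSIFIER. Nonequilibrium molecular dynamics (or equilibrium finite-N Green–Kubo) of
pinnedChain with ω₂ = lam = β = γ = 1, T = 1, δT/T = 0.1 then 0.05 (linearity check), N = 2…128: (1)
G_N must decrease to 0 roughly like 1/N — a plateau kills Recurrence (and the conjunct), increments
drifting to 0 like N^{−a} kill ResistanceQuantum; (2) the increments 1/G_{N+1} − 1/G_N must settle
to a constant 1/κ within error bars — a reproducible period-2 or wandering O(1) oscillation kills
ParabolicGerm (pivot to the averaged germ); (3) not load-bearing but diagnostic: fit R_N − r*N
against {c, c·log N, c·√N} (the card's germ fingerprint). A low-temperature run (T = 0.05, mean free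
path ≫ N) exhibits the pre-asymptotic elliptic (harmonic-like) transient, where a failure would show
first. Not run in this one-shot planner session; recommended as the refuter's first action (kit
compute), together with the lookup whether strict positivity G_N > 0 (OhmicSign) is already printed
for Langevin baths.

NUMBERS. N = 1: G_1 = γ/2 exactly (one site between two Ornstein–Uhlenbeck contacts; card). Harmonic
member lam = β = 0: G_N → c_∞(ω₂, γ) > 0, increments → 0 (RiederLebowitzLieb1967; decl
HarmonicChainBallisticFlux, not_hasBoundedResponse) — elliptic type. Disordered harmonic chain:
resistance exponential in N (hyperbolic type; AjankiHuveneers2011, decl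
AjankiHuveneers2011_scaling). φ⁴ numerics (AokiKusnezov2000 pp. 3–4, eqs. (10)–(11)): boundary jump
T_c − T_c⁰ ≃ α⟨J⟩ with α = 2.6(1), thermostat-dependent; bulk κ(T) thermostat-independent. Kinetic
regime: κ ∼ (lam T)^{−2} as T → 0 (AokiLukkarinenSpohn2006), so r*(T) → 0 and the parabolic
neighbourhood shrinks as T → 0. Items at open: 8 (target, 3 cruxes, 3 support, assembly).

DEFINITION REQUESTS. (1) InhomogeneousChain with PORT vocabulary (topic
Literature/MathematicalPhysics/KineticTheory; shared need with card
matthiessen-increments-over-anharmonic-sites): site- and bond-dependent potentials U_i, V_i and end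
baths with couplings γ_L, γ_R — generator, IsSteadyState, totalCurrent exactly as for
OscillatorChain (CuneoEckmannHairerReyBellet2018 networks cover it); on top: a thermal ENVIRONMENT E
= (finite inhomogeneous chain + Langevin bath at T at its far end), the bath map Φ E := (one
standard pinnedChain site and bond) ∘ E, the one-site functional g(E) := linear-response conductance
from a Langevin contact (γ, T + δ) on one standard site into E at T, and the orbit identity
g(Φ^{N−1}B_R) = G_N. Needed for the foreseen children JunctionLocality / InsertionCostLowerBound;
filed with `ledger workitem add --kind definition` after open. (2) NOT filed now (long horizon): the
semi-infinite equilibrium chain seen from its end — law of the end-site process under the half-line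
dynamics (LanfordLebowitzLieb1977 Thm 3, ButtaEtAl2007) — to host B* and OrbitConvergence literally;
until then B* enters only through the orbit.

Novelty: Searches (2026-08-15): `lit search --hybrid "scaling theory composition law thermal conductance
anharmonic chain adding one site recursion fixed point semi-infinite chain heat bath"` (12 docs;
Cardy 1996, arXiv:2310.13338 — nothing on a spatial recursion); `lit search --source crossref "Aoki
Kusnezov boundary jumps Fourier law Fermi-Pasta-Ulam scaling"` (→ doi:10.1103/physrevlett.86.4029)
and `… "Aoki Kusnezov bulk properties anharmonic chains strong thermal gradients"` (→
doi:10.1016/s0375-9601(99)00899-3 = arXiv:chao-dyn/9910015, read pp. 3–4: boundary jumps ≃ α⟨J⟩);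
`lit search --source crossref "thermal resistance length dependence boundary resistance anharmonic
lattice heat bath Kapitza Langevin chain"` (Kapitza literature; doi:10.1103/physreve.103.052113
Gendelman–Paul 2021: defect Kapitza resistance in chain models, no length recursion); `lit frontier
AtomisticToContinuum --since 2021` (30 rows; heat-conduction descendants arXiv:2606.08839,
arXiv:2604.14056, arXiv:2310.13338 — none recursive in N); `lit galaxy search "thermal resistance
increases linearly with the chain length" --star all` (0 rows; pdf/crabby queued out); plus the
card's audit (crossref ×3, hybrid, frontier) and the refuter novelty audit of 2026-08-15.
Nearest prior art found: AbrahamsEtAl1979 + AndersonEtAl1980 (one-parameter scaling: transport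
classes as flow types of g under added length, Ohmic ⇔ additive 1/g — the classification "in
costume", now cited); WoodsEtAl2014 (fixed point of the chain mapp  [refs: 10.1103/physrevlett.86.4029, 10.1016/s0375-9601(99, 10.1103/physreve.103.052113, 2310.13338, chao-dyn/9910015, 2606.08839, 2604.14056, doi:10.1103/physrevlett.86.4029, doi:10.1016/s0375-9601, doi:10.1103/physreve.103.052113, AbrahamsEtAl1979, AndersonEtAl1980, WoodsEtAl2014, AokiKusnezov2000, AjankiHuveneers2011]

Barriers (technique_class: environment-map-recursion parabolic-fixed-point): - technique_class: environment-map-recursion parabolic-fixed-point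
- Literature.Barriers.AtomisticToContinuum.HasBoundedResponse: not evaded — ResistanceQuantum
implies it along the unique family (it is the necessary waypoint,
hasBoundedResponse_of_fouriersLawFor); the line displaces the N-dependence from a fixed-N analysis
to ONE junction (the increment in front of a nearly closed half-line); the bet is that this is a
fixed, low-dimensional averaging problem (one site between a Markov contact and a near-equilibrium
environment).
- Literature.Barriers.AtomisticToContinuum.HarmonicChainBallisticFlux: consistent, and it shapes the
decomposition — the harmonic member is the elliptic type: Recurrence fails (G_N → c_∞ > 0,
not_hasBoundedResponse) while ResistanceQuantum and ParabolicGerm hold vacuously; so every proof of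
Recurrence must use lam, β > 0, and nothing else in the route is asked to distinguish the harmonic
chain.
- Literature.Barriers.AtomisticToContinuum.Mazur1969_inequality: applies to Recurrence — a conserved
quantity overlapping the current gives a Drude weight and G_N ↛ 0; it is the route's first kill
criterion, detected not hidden (Mazur1969_inequality.tendsto_integral_atTop).
- Literature.Barriers.AtomisticToContinuum.BeckerMenegaki2022_gapClosing: no spectral gap or
relaxation rate of the N-chain is used anywhere; the parabolic fixed point has multiplier 1 — the
recursion-side image of the closing gap — so the line expects and tolerates it.
- Literature.Barrier

History (route lifecycle, newest last):
- 2026-08-15T13:41:07Z · CLOSED retired — not-a-thesis: assembly does not conclude the sub-problem Statement (operator:999:1257524)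

sub-problem: FouriersLaw · status: closed(retired) · opened planner-plancard-AtomisticToContinuum-Fourier-74caf047-0 2026-08-15T11:16:28Z · rev 0 · ledger route-AtomisticToContinuum-BathRenormalisation
GENERATED by the gate from the ledger (D-0016/17). Provers cite these decls: `theorem foo : Summit.AtomisticToContinuum.FouriersLaw.Theses.BathRenormalisation.<Decl> := …` in Summits/AtomisticToContinuum/FouriersLaw/Theorems/<Name>.lean.
-/

namespace Summit.AtomisticToContinuum.FouriersLaw.Theses.BathRenormalisation

open scoped BigOperators Topology Manifold Classical MeasureTheory ProbabilityTheory Matrix InnerProductSpace ComplexConjugate ContinuousMap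
open Filter Set Function TopologicalSpace MeasureTheory

attribute [summit_statement] _root_.FouriersLaw

/-- item stmt-AtomisticToContinuum-3319 · target · rank 0 · closed · moot by None · by planner
why it might fail: strictly stronger than FouriersLaw (which needs only R_N/N → 1/κ): increments may tend to 0 (anomalous κ_N → ∞ despite pinning), oscillate at O(1) (coherent finite-size structure), or G_N ↛ 0 (hidden conserved quantity, Mazur).
sources: BonettoLebowitzReyBellet2000, AokiKusnezov2000, AbrahamsEtAl1979, AndersonEtAl1980, AjankiHuveneers2011
[target] X of § Thesis: under weak-NESS uniqueness, for every T > 0 there is r > 0 such that for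
every steady-state family and every conductance sequence G (G_N = lim_δ
totalCurrent(μ_{N,T+δ/2,T−δ/2})/((N−1)δ) for N ≥ 2) the resistance increments 1/G_{N+1} − 1/G_N → r;
κ(T) = 1/r. Cheap from the three cruxes + OhmicSign (r ≥ a > 0). -/
@[route_item "route-AtomisticToContinuum-BathRenormalisation"]
def BathOrbitParabolic : Prop :=
  ∀ ω₂ lam β γ : ℝ, 0 < ω₂ → 0 < lam → 0 < β → 0 < γ → (∀ (N : ℕ) (T_L T_R : ℝ), 0 < T_L → 0 < T_R → ∀ μ ν : MeasureTheory.Measure (Literature.MathematicalPhysics.KineticTheory.HeatConduction.PhaseSpace N), (Literature.MathematicalPhysics.KineticTheory.HeatConduction.pinnedChain ω₂ lam β γ).IsSteadyState N T_L T_R μ → (Literature.MathematicalPhysics.KineticTheory.HeatConduction.pinnedChain ω₂ lam β γ).IsSteadyState N T_L T_R ν → μ = ν) → ∀ T : ℝ, 0 < T → ∃ r : ℝ, 0 < r ∧ ∀ μ : (N : ℕ) → ℝ → ℝ → MeasureTheory.Measure (Literature.MathematicalPhysics.KineticTheory.HeatConduction.PhaseSpace N), (∀ (N : ℕ) (T_L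 T_R : ℝ), 0 < T_L → 0 < T_R → (Literature.MathematicalPhysics.KineticTheory.HeatConduction.pinnedChain ω₂ lam β γ).IsSteadyState N T_L T_R (μ N T_L T_R)) → ∀ G : ℕ → ℝ, (∀ N : ℕ, 2 ≤ N → Filter.Tendsto (fun δ : ℝ => (Literature.MathematicalPhysics.KineticTheory.HeatConduction.pinnedChain ω₂ lam β γ).totalCurrent (μ N (T + δ / 2) (T - δ / 2)) / (((N : ℝ) - 1) * δ)) (nhdsWithin 0 {(0 : ℝ)}ᶜ) (nhds (G N))) → Filter.Tendsto (fun N : ℕ => (G (N + 1))⁻¹ - (G N)⁻¹) Filter.atTop (nhds r)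

/-- item stmt-AtomisticToContinuum-3320 · crux · rank 2 · closed · moot by None · by planner
why it might fail: a persistent O(1) finite-size oscillation of R_N − N/κ (period-2 band-edge or contact resonances surviving at T > 0) leaves Fourier true but the increments divergent; and DC-continuity of r at B* IS N-uniform time-integrability of the junction force correlations.
sources: BonettoLebowitzReyBellet2000 §5.3 and §7, AokiKusnezov2000, WoodsEtAl2014, Dhar2008 §3, AndersonEtAl1980
[crux] card items OneSiteSeriesLemma ∘ OrbitConvergence restricted to the orbit: GIVEN that the
orbit enters every DC-neighbourhood of the closed environment (G_N → 0) and G_N > 0 (N ≥ 2), the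
resistance increments 1/G_{N+1} − 1/G_N CONVERGE to a real limit r (r(E_N) → r(B*): Φ has a C² germ
at B* along the orbit; quantifiers ∀T ∃r ∀family, legitimate under uniqueness). With
ResistanceQuantum r ≥ a > 0 and κ = 1/r. Excludes the oscillatory and the hyperbolic/insulating
(increments → ∞) types. [deps: Recurrence, ResistanceQuantum, OhmicSign] [difficulty: open-problem] -/
@[route_item "route-AtomisticToContinuum-BathRenormalisation"]
def ParabolicGerm : Prop :=
  ∀ ω₂ lam β γ : ℝ, 0 < ω₂ → 0 < lam → 0 < β → 0 < γ → (∀ (N : ℕ) (T_L T_R : ℝ), 0 < T_L → 0 < T_R → ∀ μ ν : MeasureTheory.Measure (Literature.MathematicalPhysics.KineticTheory.HeatConduction.PhaseSpace N), (Literature.MathematicalPhysics.KineticTheory.HeatConduction.pinnedChain ω₂ lam β γ).IsSteadyState N T_L T_R μ → (Literature.MathematicalPhysics.KineticTheory.HeatConduction.pinnedChain ω₂ lam β γ).IsSteadyState N T_L T_R ν → μ = ν) → ∀ T : ℝ, 0 < T → ∃ r : ℝ, ∀ μ : (N : ℕ) → ℝ → ℝ → MeasureTheory.Measure (Literature.MathematicalPhysics.KineticTheory.HeatConduction.PhaseSpace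 N), (∀ (N : ℕ) (T_L T_R : ℝ), 0 < T_L → 0 < T_R → (Literature.MathematicalPhysics.KineticTheory.HeatConduction.pinnedChain ω₂ lam β γ).IsSteadyState N T_L T_R (μ N T_L T_R)) → ∀ G : ℕ → ℝ, (∀ N : ℕ, 2 ≤ N → Filter.Tendsto (fun δ : ℝ => (Literature.MathematicalPhysics.KineticTheory.HeatConduction.pinnedChain ω₂ lam β γ).totalCurrent (μ N (T + δ / 2) (T - δ / 2)) / (((N : ℝ) - 1) * δ)) (nhdsWithin 0 {(0 : ℝ)}ᶜ) (nhds (G N))) → Filter.Tendsto G Filter.atTop (nhds 0) → (∀ N : ℕ, 2 ≤ N → 0 < G N) → Filter.Tendsto (fun N : ℕ => (G (N + 1))⁻¹ - (G N)⁻¹) Filter.atTop (nhds r)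

/-- item stmt-AtomisticToContinuum-3321 · crux · rank 3 · closed · moot by None · by planner
why it might fail: superdiffusion at some (T, ω₂, lam, β) would send the increments to 0 (believed excluded by pinning, AokiLukkarinenSpohn2006, unproved); or G_N fails to be eventually monotone (a non-positive increment infinitely often) even with Ohmic averages.
sources: AokiLukkarinenSpohn2006, LepriLiviPoliti2003, BonettoLebowitzReyBellet2000 §6.3, decl Literature.Barriers.AtomisticToContinuum.HasBoundedResponse, decl Literature.Barriers.AtomisticToContinuum.LukkarinenSpohn2008_lemma41
[crux] GIVEN G_N → 0 and G_N > 0 (N ≥ 2), eventually every added site costs at least a fixed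
resistance quantum: ∃ a > 0 with 1/G_{N+1} − 1/G_N ≥ a for all large N (r bounded away from 0 near
B*: non-degenerate quadratic tangency; quantifiers ∀T ∃a ∀family). Consequences: R_N ≥ aN/2
eventually, hence sup_N D_N < ∞ (HasBoundedResponse along the unique family) and eventual
monotonicity of G_N. Excludes the anomalous (superdiffusive, tangency order < 2) type. [deps:
Recurrence, OhmicSign] [difficulty: open-problem] -/
@[route_item "route-AtomisticToContinuum-BathRenormalisation"]
def ResistanceQuantum : Prop :=
  ∀ ω₂ lam β γ : ℝ, 0 < ω₂ → 0 < lam → 0 < β → 0 < γ → (∀ (N : ℕ) (T_L T_R : ℝ), 0 < T_L → 0 < T_R → ∀ μ ν : MeasureTheory.Measure (Literature.MathematicalPhysics.KineticTheory.HeatConduction.PhaseSpace N), (Literature.MathematicalPhysics.KineticTheory.HeatConduction.pinnedChain ω₂ lam β γ).IsSteadyState N T_L T_R μ → (Literature.MathematicalPhysics.KineticTheory.HeatConduction.pinnedChain ω₂ lam β γ).IsSteadyState N T_L T_R ν → μ = ν) → ∀ T : ℝ, 0 < T → ∃ a : ℝ, 0 < a ∧ ∀ μ : (N : ℕ) → ℝ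 → ℝ → MeasureTheory.Measure (Literature.MathematicalPhysics.KineticTheory.HeatConduction.PhaseSpace N), (∀ (N : ℕ) (T_L T_R : ℝ), 0 < T_L → 0 < T_R → (Literature.MathematicalPhysics.KineticTheory.HeatConduction.pinnedChain ω₂ lam β γ).IsSteadyState N T_L T_R (μ N T_L T_R)) → ∀ G : ℕ → ℝ, (∀ N : ℕ, 2 ≤ N → Filter.Tendsto (fun δ : ℝ => (Literature.MathematicalPhysics.KineticTheory.HeatConduction.pinnedChain ω₂ lam β γ).totalCurrent (μ N (T + δ / 2) (T - δ / 2)) / (((N : ℝ) - 1) * δ)) (nhdsWithin 0 {(0 : ℝ)}ᶜ) (nhds (G N))) → Filter.Tendsto G Filter.atTop (nhds 0) → (∀ N : ℕ, 2 ≤ N → 0 < G N) → ∀ᶠ N : ℕ in Filter.atTop, a ≤ (G (N + 1))⁻¹ - (G N)⁻¹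

/-- item stmt-AtomisticToContinuum-3322 · crux · rank 4 · closed · moot by None · by planner
why it might fail: a local conserved quantity of the quartic pinned chain overlapping the energy current (Mazur ⇒ Drude weight > 0 ⇒ G_N ↛ 0), or exact non-radiating moving breathers; none is known, but integrability is excluded only numerically.
sources: Mazur1969, decl Literature.Barriers.AtomisticToContinuum.Mazur1969_inequality, Dhar2008, RiederLebowitzLieb1967, decl Literature.Barriers.AtomisticToContinuum.HarmonicChainBallisticFlux, KunduDharNarayan2009
[crux] card item Recurrence (g(B*) = 0) on the orbit: the chain conductance tends to zero, G_N(T) →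
0 as N → ∞, for every steady-state family under uniqueness — the semi-infinite pinned anharmonic
chain is CLOSED at DC, no ballistic channel; equivalently D_N = o(N). Strictly weaker than
HasBoundedResponse and than the conjunct; the first deliverable. Excludes the elliptic/ballistic
type (the harmonic member fails exactly here: G_N → c_∞ > 0). [difficulty: open-problem] -/
@[route_item "route-AtomisticToContinuum-BathRenormalisation"]
def Recurrence : Prop :=
  ∀ ω₂ lam β γ : ℝ, 0 < ω₂ → 0 < lam → 0 < β → 0 < γ → (∀ (N : ℕ) (T_L T_R : ℝ), 0 < T_L → 0 < T_R → ∀ μ ν : MeasureTheory.Measure (Literature.MathematicalPhysics.KineticTheory.HeatConduction.PhaseSpace N), (Literature.MathematicalPhysics.KineticTheory.HeatConduction.pinnedChain ω₂ lam β γ).IsSteadyState N T_L T_R μ → (Literature.MathematicalPhysics.KineticTheory.HeatConduction.pinnedChain ω₂ lam β γ).IsSteadyState N T_L T_R ν → μ = ν) → ∀ μ : (N : ℕ) → ℝ → ℝ → MeasureTheory.Measure (Literature.MathematicalPhysics.KineticTheory.HeatConduction.PhaseSpace N), (∀ (N : ℕ) (T_L T_R : ℝ), 0 < T_L → 0 <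 T_R → (Literature.MathematicalPhysics.KineticTheory.HeatConduction.pinnedChain ω₂ lam β γ).IsSteadyState N T_L T_R (μ N T_L T_R)) → ∀ T : ℝ, 0 < T → ∀ G : ℕ → ℝ, (∀ N : ℕ, 2 ≤ N → Filter.Tendsto (fun δ : ℝ => (Literature.MathematicalPhysics.KineticTheory.HeatConduction.pinnedChain ω₂ lam β γ).totalCurrent (μ N (T + δ / 2) (T - δ / 2)) / (((N : ℝ) - 1) * δ)) (nhdsWithin 0 {(0 : ℝ)}ᶜ) (nhds (G N))) → Filter.Tendsto G Filter.atTop (nhds 0)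

/-- item stmt-AtomisticToContinuum-0717 · support · rank 9 · closed · proved by Summit.AtomisticToContinuum.FouriersLaw.Theorems.FourierGreenKubo.finiteResponseOfUnique_holds (prover) · by planner
sources: ReyBellet2003, HairerMajda2009, CuneoEckmannHairerReyBellet2018
CONDITIONAL FORM OF 0705 (supersedes it as the prover target; refuters pool-5/g3-0: 0705 stand-alone
quantifies over EVERY steady-state family and is false-prone if weak steady states were non-unique):
assuming UNIQUENESS of weak steady states (IsSteadyState class) for pinnedChain at all N, T_L, T_R >
0, the finite-N linear-response limit D_N(T) = lim_{δ→0, δ≠0} totalCurrent(μ_{N,T+δ/2,T−δ/2})/δ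
exists for every T > 0 and N. Content: differentiability at equilibrium of NESS expectations of the
polynomial currents in the bath temperatures (ReyBellet2003 arXiv:math-ph/0303021 Rem 4.4 (51)–(56)
finite-volume Green–Kubo; HairerMajda2009 arXiv:0909.4313 Thm 2.3 framework — their SDE Thm 4.4
Assumption 5 fails here, so verify Assumptions 1–3 via CEHR2018 (2.5)/Carmona2007 Thm 1.1(iv)
weighted spectral gap). N = 0, 1: totalCurrent ≡ 0, D = 0. Together with 0706 gives 0705. -/
@[route_item "route-AtomisticToContinuum-BathRenormalisation"]
def FiniteResponseOfUnique : Prop :=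
  ∀ ω₂ lam β γ : ℝ, 0 < ω₂ → 0 < lam → 0 < β → 0 < γ → (∀ (N : ℕ) (T_L T_R : ℝ), 0 < T_L → 0 < T_R → ∀ μ ν : MeasureTheory.Measure (Literature.MathematicalPhysics.KineticTheory.HeatConduction.PhaseSpace N), (Literature.MathematicalPhysics.KineticTheory.HeatConduction.pinnedChain ω₂ lam β γ).IsSteadyState N T_L T_R μ → (Literature.MathematicalPhysics.KineticTheory.HeatConduction.pinnedChain ω₂ lam β γ).IsSteadyState N T_L T_R ν → μ = ν) → ∀ μ : (N : ℕ) → ℝ → ℝ → MeasureTheory.Measure (Literature.MathematicalPhysics.KineticTheory.HeatConduction.PhaseSpace N), (∀ (N : ℕ) (T_L T_R : ℝ), 0 < T_L → 0 < T_R → (Literature.MathematicalPhysics.KineticTheory.HeatConduction.pinnedChain ω₂ lam β γ).IsSteadyState N T_L T_R (μ N T_L T_R)) → ∀ T : ℝ, 0 < T → ∀ N : ℕ, ∃ D : ℝ, Filter.Tendsto (fun δ : ℝ => (Literature.MathematicalPhysics.KineticTheory.HeatConduction.pinnedChain ω₂ lam β γ).totalCurrent (μ N (T + δ / 2) (T -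 δ / 2)) / δ) (nhdsWithin 0 {(0 : ℝ)}ᶜ) (nhds D)

/-- `FiniteResponseOfUnique` holds: proved by `Summit.AtomisticToContinuum.FouriersLaw.Theorems.FourierGreenKubo.finiteResponseOfUnique_holds`. -/
theorem FiniteResponseOfUnique_holds : FiniteResponseOfUnique := _root_.Summit.AtomisticToContinuum.FouriersLaw.Theorems.FourierGreenKubo.finiteResponseOfUnique_holds

/-- item stmt-AtomisticToContinuum-0741 · support · rank 9 · closed · proved by Summit.AtomisticToContinuum.FouriersLaw.Theorems.nessUnique_proof (prover) · by planner
sources: CuneoEckmannHairerReyBellet2018, Carmona2007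
[crux] UNIQUENESS OF THE WEAK STEADY STATE (the half of stmt-0706 not covered by the landed fact
Literature.MathematicalPhysics.KineticTheory.HeatConduction.CuneoEckmannHairerReyBellet2018_pinnedChain,
p3544): for pinnedChain ω₂ lam β γ (all > 0), every N and T_L, T_R > 0, any two measures in the weak
Fokker–Planck class IsSteadyState (probability, ∫ L f dμ = 0 for f ∈ C_c^∞, bond currents
integrable) coincide. Print: uniqueness of the INVARIANT MEASURE of the Langevin semigroup
(CuneoEckmannHairerReyBellet2018 Thm 2.13(1): C1, C2, CA; Carmona2007 Thm 1.1(iii)); the item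
additionally needs 'weak stationary probability solution of L*μ = 0 ⇒ P_t-invariant' for this
hypoelliptic L with cubic drift (Echeverría 1982 well-posed martingale problem on C_c^∞ +
non-explosion via e^{θH}; Bogachev–Krylov–Röckner–Shaposhnikov 2015 Ch. 5 is non-degenerate only) —
the FP-identification lemma is the formal crux. N = 0: PhaseSpace 0 is a point (unique probability
measure); N = 1: both baths on site 0, OU at temperature (T_L+T_R)/2. This is exactly the hypothesis
of FiniteResponse and ThermodynamicLimit and, with the fact, gives clause (i) of FouriersLawFor. -/
@[route_item "route-AtomisticToContinuum-BathRenormalisation"]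
def NessUnique : Prop :=
  ∀ ω₂ lam β γ : ℝ, 0 < ω₂ → 0 < lam → 0 < β → 0 < γ → ∀ (N : ℕ) (T_L T_R : ℝ), 0 < T_L → 0 < T_R → ∀ μ ν : MeasureTheory.Measure (Literature.MathematicalPhysics.KineticTheory.HeatConduction.PhaseSpace N), (Literature.MathematicalPhysics.KineticTheory.HeatConduction.pinnedChain ω₂ lam β γ).IsSteadyState N T_L T_R μ → (Literature.MathematicalPhysics.KineticTheory.HeatConduction.pinnedChain ω₂ lam β γ).IsSteadyState N T_L T_R ν → μ = ν

/-- `NessUnique` holds: proved by `Summit.AtomisticToContinuum.FouriersLaw.Theorems.nessUnique_proof`. -/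
theorem NessUnique_holds : NessUnique := _root_.Summit.AtomisticToContinuum.FouriersLaw.Theorems.nessUnique_proof

/-- item stmt-AtomisticToContinuum-3323 · support · rank 9 · closed · moot by None · by planner
sources: ReyBellet2003, EckmannPilletReyBellet1999b, CuneoEckmannHairerReyBellet2018
[support] strict positivity of the finite-N conductance, G_N(T) > 0 for all N ≥ 2, every
steady-state family under uniqueness (non-degeneracy of the finite-volume Kubo variance of the
contact power w_L = γ(T − p_0²): w_L is not a coboundary L h with ∂_p h = 0 on the bath momenta).
Print-level routine given the finite-volume Green–Kubo formula (ReyBellet2003 Rem 4.4 (56)) and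
strict entropy production (EckmannPilletReyBellet1999b); infrastructure-heavy in Lean (Markov
semigroup of the chain). Load-bearing: antecedent of ResistanceQuantum and ParabolicGerm.
[difficulty: L] -/
@[route_item "route-AtomisticToContinuum-BathRenormalisation"]
def OhmicSign : Prop :=
  ∀ ω₂ lam β γ : ℝ, 0 < ω₂ → 0 < lam → 0 < β → 0 < γ → (∀ (N : ℕ) (T_L T_R : ℝ), 0 < T_L → 0 < T_R → ∀ μ ν : MeasureTheory.Measure (Literature.MathematicalPhysics.KineticTheory.HeatConduction.PhaseSpace N), (Literature.MathematicalPhysics.KineticTheory.HeatConduction.pinnedChain ω₂ lam β γ).IsSteadyState N T_L T_R μ → (Literature.MathematicalPhysics.KineticTheory.HeatConduction.pinnedChain ω₂ lam β γ).IsSteadyState N T_L T_R ν → μ = ν) → ∀ μ : (N : ℕ) → ℝ → ℝ → MeasureTheory.Measure (Literature.MathematicalPhysics.KineticTheory.HeatConduction.PhaseSpace N), (∀ (N : ℕ) (T_L T_R : ℝ), 0 < T_L → 0 < T_R → (Literature.MathematicalPhysics.KineticTheory.HeatConduction.pinnedChain ω₂ lam β γ).IsSteadyState N T_L T_R (μ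 N T_L T_R)) → ∀ T : ℝ, 0 < T → ∀ G : ℕ → ℝ, (∀ N : ℕ, 2 ≤ N → Filter.Tendsto (fun δ : ℝ => (Literature.MathematicalPhysics.KineticTheory.HeatConduction.pinnedChain ω₂ lam β γ).totalCurrent (μ N (T + δ / 2) (T - δ / 2)) / (((N : ℝ) - 1) * δ)) (nhdsWithin 0 {(0 : ℝ)}ᶜ) (nhds (G N))) → ∀ N : ℕ, 2 ≤ N → 0 < G N

/-- item stmt-AtomisticToContinuum-3324 · assembly · rank 1 · closed · moot by None · by planner
sources: BonettoLebowitzReyBellet2000, CuneoEckmannHairerReyBellet2018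
[assembly] CuneoEckmannHairerReyBellet2018_pinnedChain → NessUnique → FiniteResponseOfUnique →
OhmicSign → Recurrence → ResistanceQuantum → ParabolicGerm → FouriersLaw. -/
@[route_item "route-AtomisticToContinuum-BathRenormalisation"]
def Assembly : Prop :=
  Literature.MathematicalPhysics.KineticTheory.HeatConduction.CuneoEckmannHairerReyBellet2018_pinnedChain → NessUnique → FiniteResponseOfUnique → OhmicSign → Recurrence → ResistanceQuantum → ParabolicGerm → Literature.MathematicalPhysics.KineticTheory.HeatConduction.FouriersLaw

end Summit.AtomisticToContinuum.FouriersLaw.Theses.BathRenormalisation
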